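import Summits.ValiantsHypothesis.ValiantsHypothesis.Theorems.DefinabilityGapLexCertificate
import HarnessLib

/-!
# DefinabilityGap — ZERO-PATTERN SPECIALISATION of the planted Kabanets–Impagliazzo permanent design (unconditional)

Route `route-ValiantsHypothesis-DefinabilityGap` (decomp-valiant cycle 1, lens 5, gen 7), supporting the hitting item
`KIPlantedHitting` (stmt-ValiantsHypothesis-23547) through its size road R_K1.1 («every `2q(m)+1` block permanents
`P_c = per_m(y|S_c)` of the planted generator are algebraically independent, eventually in `m`»).

THE LEVER. Setting a set `W` of seed cells to `0` is an algebra endomorphism `zeroSpec W` of the seed polynomial ring, so it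
PRESERVES algebraic dependence: a certificate of independence for the specialised blocks `P_c^W = per_m(y|S_c)|_{y_W = 0}`
(the sum over the transversals of the block AVOIDING `W`, `zeroSpec_kiPer`) is a certificate for the blocks themselves
(`AlgebraicIndependent.of_comp`). This file ports the lex-leading-monomial criterion of `DefinabilityGapLexCertificate` to
the specialised family: `kiPerZ_hits_of_injOn` (injective leading sums ⟹ hitting) and
`kiPer_algebraicIndependent_of_linearIndependentZ` (ℚ-independent specialised leading diagonals `d_c^{W,π}` over live blocks
⟹ the BLOCKS `(P_c)_{c ∈ T}` are algebraically independent). The companion file `DefinabilityGapZeroPattern` turns it into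
the size-free ZERO-PATTERN RUNG (top live cells). 0 sorry.
-/

noncomputable section

open MvPolynomial
open Literature.Computability.AlgebraicComplexity Literature.Computability.MetaComplexity
open Summit.ValiantsHypothesis.ValiantsHypothesis.Theorems.DefinabilityGapAffineRung
open Summit.ValiantsHypothesis.ValiantsHypothesis.Theorems.DefinabilityGapLexCertificate

namespace Summit.ValiantsHypothesis.ValiantsHypothesis.Theorems.DefinabilityGapZeroSpecialisation

variable {τ : Type*} [LinearOrder τ] [WellFoundedGT τ]

/-! ## 1. Zero-pattern specialisation -/

/-- The specialisation `y_x ↦ 0` (`x ∈ W`), `y_x ↦ y_x` otherwise, as a `ℂ`-algebra endomorphism. [this file] -/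
def zeroSpec {σ : Type*} [DecidableEq σ] (W : Finset σ) : MvPolynomial σ ℂ →ₐ[ℂ] MvPolynomial σ ℂ :=
  aeval fun x => if x ∈ W then 0 else X x

/-- **Specialisation preserves dependence**: independence of the specialised family certifies independence. [this file] -/
theorem algebraicIndependent_of_zeroSpec {σ ι : Type*} [DecidableEq σ] (W : Finset σ) (P : ι → MvPolynomial σ ℂ)
    (h : AlgebraicIndependent ℂ (fun i => zeroSpec W (P i))) : AlgebraicIndependent ℂ P :=
  AlgebraicIndependent.of_comp (zeroSpec W) h

/-- The transversals (permutation patterns) of the block `S_c` avoiding the zero set `W`. [this file] -/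
def avoidSet (m : ℕ) (W : Finset (Fin (qOf m) × Fin (qOf m))) (c : Fin 3 → Fin (qOf m)) :
    Finset (Equiv.Perm (Fin m)) :=
  Finset.univ.filter fun ρ => ∀ i, cellEmb m c (ρ i, i) ∉ W

/-- Membership in `avoidSet`. [this file] -/
theorem mem_avoidSet {m : ℕ} {W : Finset (Fin (qOf m) × Fin (qOf m))} {c : Fin 3 → Fin (qOf m)}
    {ρ : Equiv.Perm (Fin m)} : ρ ∈ avoidSet m W c ↔ ∀ i, cellEmb m c (ρ i, i) ∉ W := by
  simp [avoidSet]

/-- A permutation monomial is the product of its variables. [folklore] -/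
theorem monomial_mapDomain_permMonomial {m : ℕ} {β : Type*} (f : Fin m × Fin m → β) (ρ : Equiv.Perm (Fin m)) :
    (monomial (Finsupp.mapDomain f (permMonomial ρ)) (1 : ℂ) : MvPolynomial β ℂ) = ∏ i, X (f (ρ i, i)) := by
  classical
  rw [permMonomial, Finsupp.mapDomain_finsetSum]
  simp_rw [Finsupp.mapDomain_single]
  rw [monomial_sum_one]
  rfl

/-- **The specialised block permanent**: `P_c|_{y_W = 0} = Σ_{ρ avoiding W} ∏_i y_{E_c(ρ i, i)}`. [this file] -/
theorem zeroSpec_kiPer (m : ℕ) (W : Finset (Fin (qOf m) × Fin (qOf m))) (c : Fin 3 → Fin (qOf m)) :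
    zeroSpec W (kiPer m c) = ∑ ρ ∈ avoidSet m W c, ∏ i, X (cellEmb m c (ρ i, i)) := by
  classical
  rw [kiPer_eq_rename_cellEmb, perPoly_eq_sum_monomial, map_sum, map_sum, avoidSet, Finset.sum_filter]
  refine Finset.sum_congr rfl fun ρ _ => ?_
  rw [rename_monomial, monomial_mapDomain_permMonomial, map_prod]
  simp_rw [zeroSpec, aeval_X]
  by_cases h : ∀ i, cellEmb m c (ρ i, i) ∉ W
  · rw [if_pos h]
    exact Finset.prod_congr rfl fun i _ => if_neg (h i)
  · rw [if_neg h]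
    push Not at h
    obtain ⟨i, hi⟩ := h
    exact Finset.prod_eq_zero (Finset.mem_univ i) (if_pos hi)

/-! ## 2. The specialised, ranked coordinate and its coefficients -/

/-- `P_c^W` with the seed cells renamed along a ranking `π`: `Σ_{ρ avoiding W} y^{π E_c μ_ρ}`. [this file] -/
def kiPerZ (m : ℕ) (W : Finset (Fin (qOf m) × Fin (qOf m))) (π : (Fin (qOf m) × Fin (qOf m)) → τ)
    (c : Fin 3 → Fin (qOf m)) : MvPolynomial τ ℂ :=
  ∑ ρ ∈ avoidSet m W c, monomial (Finsupp.mapDomain (π ∘ (cellEmb m c)) (permMonomial ρ)) 1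

omit [LinearOrder τ] [WellFoundedGT τ] in
/-- `kiPerZ` is the ranked specialisation of the block permanent. [this file] -/
theorem kiPerZ_eq (m : ℕ) (W : Finset (Fin (qOf m) × Fin (qOf m))) (π : (Fin (qOf m) × Fin (qOf m)) → τ)
    (c : Fin 3 → Fin (qOf m)) : kiPerZ m W π c = rename π (zeroSpec W (kiPer m c)) := by
  classical
  rw [zeroSpec_kiPer, map_sum, kiPerZ]
  refine Finset.sum_congr rfl fun ρ _ => ?_
  rw [monomial_mapDomain_permMonomial, map_prod]
  simp_rw [rename_X]
  rfl

omit [LinearOrder τ] [WellFoundedGT τ] in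
/-- An avoiding permutation monomial has coefficient `1`. [this file] -/
theorem coeff_kiPerZ_of_mem (m : ℕ) {W : Finset (Fin (qOf m) × Fin (qOf m))} {π : (Fin (qOf m) × Fin (qOf m)) → τ}
    (hπ : Function.Injective π) (c : Fin 3 → Fin (qOf m)) {ρ : Equiv.Perm (Fin m)} (hρ : ρ ∈ avoidSet m W c) :
    coeff (Finsupp.mapDomain (π ∘ (cellEmb m c)) (permMonomial ρ)) (kiPerZ m W π c) = 1 := by
  classical
  rw [kiPerZ, coeff_sum, Finset.sum_eq_single ρ]
  · rw [coeff_monomial, if_pos rfl]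
  · intro ρ' _ hne
    rw [coeff_monomial, if_neg]
    exact fun h => hne (permMonomial_injective
      (Finsupp.mapDomain_injective (hπ.comp (cellEmb m c).injective) h))
  · intro h
    exact absurd hρ h

omit [LinearOrder τ] [WellFoundedGT τ] in
/-- The support of `P_c^W` consists of avoiding permutation monomials. [this file] -/
theorem exists_of_coeff_kiPerZ_ne_zero (m : ℕ) {W : Finset (Fin (qOf m) × Fin (qOf m))}
    {π : (Fin (qOf m) × Fin (qOf m)) → τ} (c : Fin 3 → Fin (qOf m)) {d : τ →₀ ℕ}
    (h : coeff d (kiPerZ m W π c) ≠ 0) :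
    ∃ ρ ∈ avoidSet m W c, Finsupp.mapDomain (π ∘ (cellEmb m c)) (permMonomial ρ) = d := by
  classical
  by_contra hne
  push Not at hne
  apply h
  rw [kiPerZ, coeff_sum]
  exact Finset.sum_eq_zero fun ρ hρ => by rw [coeff_monomial, if_neg (hne ρ hρ)]

omit [LinearOrder τ] [WellFoundedGT τ] in
/-- A block with an avoiding transversal has a nonzero specialised permanent. [this file] -/
theorem kiPerZ_ne_zero (m : ℕ) {W : Finset (Fin (qOf m) × Fin (qOf m))} {π : (Fin (qOf m) × Fin (qOf m)) → τ}
    (hπ : Function.Injective π) (c : Fin 3 → Fin (qOf m)) (hA : (avoidSet m W c).Nonempty) : kiPerZ m W π c ≠ 0 := by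
  obtain ⟨ρ, hρ⟩ := hA
  intro h
  have := coeff_kiPerZ_of_mem m hπ c hρ
  rw [h, coeff_zero] at this
  exact zero_ne_one this

/-! ## 3. Leading exponents of the specialised coordinates -/

/-- The lex-leading exponent of `P_c^W` (a `W`-avoiding permutation pattern of the block). [this file] -/
def leadExpZ (m : ℕ) (W : Finset (Fin (qOf m) × Fin (qOf m))) (π : (Fin (qOf m) × Fin (qOf m)) → τ)
    (c : Fin 3 → Fin (qOf m)) : τ →₀ ℕ :=
  (lexOrdR τ).degree (kiPerZ m W π c)

/-- `d_c^{W,π}` is a `W`-avoiding ranked permutation pattern of the block. [this file] -/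
theorem exists_leadExpZ_eq (m : ℕ) {W : Finset (Fin (qOf m) × Fin (qOf m))} {π : (Fin (qOf m) × Fin (qOf m)) → τ}
    (hπ : Function.Injective π) (c : Fin 3 → Fin (qOf m)) (hA : (avoidSet m W c).Nonempty) :
    ∃ ρ ∈ avoidSet m W c, leadExpZ m W π c = Finsupp.mapDomain (π ∘ (cellEmb m c)) (permMonomial ρ) := by
  have hmem : leadExpZ m W π c ∈ (kiPerZ m W π c).support :=
    (lexOrdR τ).degree_mem_support (kiPerZ_ne_zero m hπ c hA)
  rw [mem_support_iff] at hmem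
  obtain ⟨ρ, hρ, h⟩ := exists_of_coeff_kiPerZ_ne_zero m c hmem
  exact ⟨ρ, hρ, h.symm⟩

/-- `d_c^{W,π}` is `0/1`-valued. [this file] -/
theorem leadExpZ_apply_le_one (m : ℕ) {W : Finset (Fin (qOf m) × Fin (qOf m))} {π : (Fin (qOf m) × Fin (qOf m)) → τ}
    (hπ : Function.Injective π) (c : Fin 3 → Fin (qOf m)) (hA : (avoidSet m W c).Nonempty) (x : τ) :
    leadExpZ m W π c x ≤ 1 := by
  obtain ⟨ρ, -, h⟩ := exists_leadExpZ_eq m hπ c hA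
  rw [h]
  exact mapDomain_permMonomial_apply_le_one (hπ.comp (cellEmb m c).injective) ρ x

/-- Every cell of the leading pattern is a LIVE cell of the block: it lies on a `W`-avoiding transversal. [this file] -/
theorem live_of_leadExpZ_ne_zero (m : ℕ) {W : Finset (Fin (qOf m) × Fin (qOf m))} {π : (Fin (qOf m) × Fin (qOf m)) → τ}
    (hπ : Function.Injective π) (c : Fin 3 → Fin (qOf m)) (hA : (avoidSet m W c).Nonempty) {x : τ}
    (hx : leadExpZ m W π c x ≠ 0) :
    ∃ p : Fin m × Fin m, π (cellEmb m c p) = x ∧ ∃ ρ ∈ avoidSet m W c, ρ p.2 = p.1 := by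
  classical
  obtain ⟨ρ, hρ, h⟩ := exists_leadExpZ_eq m hπ c hA
  rw [h] at hx
  have hmem : x ∈ (Finsupp.mapDomain (π ∘ (cellEmb m c)) (permMonomial ρ)).support := Finsupp.mem_support_iff.2 hx
  rw [Finsupp.mapDomain_support_of_injective (hπ.comp (cellEmb m c).injective)] at hmem
  obtain ⟨p, hp, rfl⟩ := Finset.mem_image.1 hmem
  refine ⟨p, rfl, ρ, hρ, ?_⟩
  have h1 := Finsupp.mem_support_iff.1 hp
  obtain ⟨a, b⟩ := p
  rw [permMonomial_apply] at h1
  by_contra h2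
  exact h1 (if_neg h2)


/-- The leading exponent of the power product `∏_c (P_c^W)^{e_c}`: `Σ_c e_c • d_c^{W,π}`. [this file] -/
def leadSumZ (m : ℕ) (W : Finset (Fin (qOf m) × Fin (qOf m))) (π : (Fin (qOf m) × Fin (qOf m)) → τ)
    (e : (Fin 3 → Fin (qOf m)) →₀ ℕ) : τ →₀ ℕ :=
  e.sum fun c n => n • leadExpZ m W π c

omit [LinearOrder τ] [WellFoundedGT τ] in
/-- A term `a · ∏_c (P_c^W)^{e_c}` with `a ≠ 0` and every `c ∈ supp e` live is nonzero. [this file] -/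
theorem term_ne_zeroZ (m : ℕ) {W : Finset (Fin (qOf m) × Fin (qOf m))} {π : (Fin (qOf m) × Fin (qOf m)) → τ}
    (hπ : Function.Injective π) (e : (Fin 3 → Fin (qOf m)) →₀ ℕ) (he : ∀ c ∈ e.support, (avoidSet m W c).Nonempty)
    {a : ℂ} (ha : a ≠ 0) : bind₁ (kiPerZ m W π) (monomial e a) ≠ 0 := by
  rw [bind₁_monomial]
  exact mul_ne_zero (C_eq_zero.not.2 ha)
    (Finset.prod_ne_zero_iff.2 fun c hc => pow_ne_zero _ (kiPerZ_ne_zero m hπ c (he c hc)))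

/-- The lex-leading exponent of such a term is `Σ_c e_c • d_c^{W,π}`. [this file] -/
theorem degree_termZ (m : ℕ) {W : Finset (Fin (qOf m) × Fin (qOf m))} {π : (Fin (qOf m) × Fin (qOf m)) → τ}
    (hπ : Function.Injective π) (e : (Fin 3 → Fin (qOf m)) →₀ ℕ) (he : ∀ c ∈ e.support, (avoidSet m W c).Nonempty)
    {a : ℂ} (ha : a ≠ 0) :
    (lexOrdR τ).degree (bind₁ (kiPerZ m W π) (monomial e a)) = leadSumZ m W π e := by
  classical
  have hprod : (∏ c ∈ e.support, kiPerZ m W π c ^ e c) ≠ 0 :=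
    Finset.prod_ne_zero_iff.2 fun c hc => pow_ne_zero _ (kiPerZ_ne_zero m hπ c (he c hc))
  rw [bind₁_monomial, (lexOrdR τ).degree_mul (C_eq_zero.not.2 ha) hprod, (lexOrdR τ).degree_C, zero_add,
    (lexOrdR τ).degree_prod (fun c hc => pow_ne_zero _ (kiPerZ_ne_zero m hπ c (he c hc)))]
  simp_rw [(lexOrdR τ).degree_pow]
  rfl

/-! ## 4. Injectivity of leading sums ⟹ the specialised family is hit -/

/-- If `e ↦ Σ_c e_c • d_c^{W,π}` is injective on a set `S` of exponents using live coordinates only, no nonzero `D`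
supported on `S` annihilates the specialised generator. [this file] -/
theorem kiPerZ_hits_of_injOn (m : ℕ) {W : Finset (Fin (qOf m) × Fin (qOf m))} {π : (Fin (qOf m) × Fin (qOf m)) → τ}
    (hπ : Function.Injective π) (S : Set ((Fin 3 → Fin (qOf m)) →₀ ℕ)) (hinj : Set.InjOn (leadSumZ m W π) S)
    (hlive : ∀ e ∈ S, ∀ c ∈ e.support, (avoidSet m W c).Nonempty)
    (D : MvPolynomial (Fin 3 → Fin (qOf m)) ℂ) (hD : D ≠ 0) (hS : ∀ e ∈ D.support, e ∈ S) :
    bind₁ (kiPerZ m W π) D ≠ 0 := by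
  classical
  have hne : D.support.Nonempty := Finset.nonempty_iff_ne_empty.2 fun h => hD (support_eq_empty.1 h)
  obtain ⟨e₀, he₀, hmax⟩ := Finset.exists_max_image D.support (fun e => (lexOrdR τ).toSyn (leadSumZ m W π e)) hne
  have key : coeff (leadSumZ m W π e₀) (bind₁ (kiPerZ m W π) D) =
      coeff (leadSumZ m W π e₀) (bind₁ (kiPerZ m W π) (monomial e₀ (coeff e₀ D))) := by
    conv_lhs => rw [D.as_sum, map_sum, coeff_sum]
    rw [Finset.sum_eq_single e₀]
    · intro e he hne'
      apply (lexOrdR τ).coeff_eq_zero_of_lt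
      rw [degree_termZ m hπ e (hlive e (hS e he)) (mem_support_iff.1 he)]
      exact lt_of_le_of_ne (hmax e he) fun h =>
        hne' (hinj (hS e he) (hS e₀ he₀) ((lexOrdR τ).toSyn.injective h))
    · intro h
      exact absurd he₀ h
  intro h0
  rw [h0, coeff_zero] at key
  have hT0 := term_ne_zeroZ m hπ e₀ (hlive e₀ (hS e₀ he₀)) (mem_support_iff.1 he₀)
  apply ((lexOrdR τ).leadingCoeff_ne_zero_iff.2 hT0)
  show coeff ((lexOrdR τ).degree _) _ = 0
  rw [degree_termZ m hπ e₀ (hlive e₀ (hS e₀ he₀)) (mem_support_iff.1 he₀)]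
  exact key.symm

/-! ## 5. Linear independence of the specialised leading diagonals ⟹ algebraic independence of the blocks -/

/-- The specialised leading diagonal as a `ℚ`-valued `0/1` vector. [this file] -/
def leadVecZ (m : ℕ) (W : Finset (Fin (qOf m) × Fin (qOf m))) (π : (Fin (qOf m) × Fin (qOf m)) → τ)
    (c : Fin 3 → Fin (qOf m)) : τ → ℚ :=
  fun x => (leadExpZ m W π c x : ℚ)

/-- Coordinates of `Σ_c e_c • d_c^{W,π}`, over `ℚ`. [this file] -/
theorem leadSumZ_apply (m : ℕ) (W : Finset (Fin (qOf m) × Fin (qOf m))) (π : (Fin (qOf m) × Fin (qOf m)) → τ)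
    (e : (Fin 3 → Fin (qOf m)) →₀ ℕ) (x : τ) :
    ((leadSumZ m W π e x : ℕ) : ℚ) = ∑ c ∈ e.support, (e c : ℚ) * leadVecZ m W π c x := by
  rw [leadSumZ, Finsupp.sum_apply, Finsupp.sum, Nat.cast_sum]
  refine Finset.sum_congr rfl fun c _ => ?_
  rw [Finsupp.smul_apply, smul_eq_mul, Nat.cast_mul]
  rfl

/-- `ℚ`-linear independence of `(d_c^{W,π})_{c ∈ T}` makes `e ↦ Σ_c e_c • d_c^{W,π}` injective on exponents supported
in `T`. [this file] -/
theorem injOn_of_linearIndependentZ (m : ℕ) (W : Finset (Fin (qOf m) × Fin (qOf m)))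
    (π : (Fin (qOf m) × Fin (qOf m)) → τ) (T : Finset (Fin 3 → Fin (qOf m)))
    (hli : LinearIndependent ℚ (fun c : T => leadVecZ m W π (c : Fin 3 → Fin (qOf m)))) :
    Set.InjOn (leadSumZ m W π) {e | e.support ⊆ T} := by
  classical
  intro e he e' he' h
  have he1 : e.support ⊆ T := he
  have he2 : e'.support ⊆ T := he'
  have hx : ∀ x, ∑ c ∈ T, ((e c : ℚ) - e' c) * leadVecZ m W π c x = 0 := by
    intro x
    have h1 : ((leadSumZ m W π e x : ℕ) : ℚ) = ((leadSumZ m W π e' x : ℕ) : ℚ) := by rw [h]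
    rw [leadSumZ_apply, leadSumZ_apply,
      Finset.sum_subset he1 (fun c _ hc => by rw [Finsupp.notMem_support_iff.1 hc]; simp),
      Finset.sum_subset he2 (fun c _ hc => by rw [Finsupp.notMem_support_iff.1 hc]; simp)] at h1
    simp_rw [sub_mul, Finset.sum_sub_distrib, h1, sub_self]
  have hfun : ∑ c : T, ((e c : ℚ) - e' c) • leadVecZ m W π (c : Fin 3 → Fin (qOf m)) = 0 := by
    ext x
    rw [Finset.sum_apply, Pi.zero_apply]
    simp_rw [Pi.smul_apply, smul_eq_mul]
    rw [Finset.sum_coe_sort T (fun c => ((e c : ℚ) - e' c) * leadVecZ m W π c x)]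
    exact hx x
  have hg := (Fintype.linearIndependent_iff.1 hli) (fun c : T => (e c : ℚ) - e' c) hfun
  ext c
  by_cases hc : c ∈ T
  · have h2 := hg ⟨c, hc⟩
    exact_mod_cast sub_eq_zero.1 h2
  · rw [Finsupp.notMem_support_iff.1 (fun h' => hc (he1 h')), Finsupp.notMem_support_iff.1 (fun h' => hc (he2 h'))]

/-- Linear independence of the specialised leading diagonals over a family of live blocks makes the SPECIALISED blocks
algebraically independent. [this file] -/
theorem kiPerZ_algebraicIndependent_of_linearIndependent (m : ℕ) {W : Finset (Fin (qOf m) × Fin (qOf m))}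
    {π : (Fin (qOf m) × Fin (qOf m)) → τ} (hπ : Function.Injective π) (T : Finset (Fin 3 → Fin (qOf m)))
    (hA : ∀ c ∈ T, (avoidSet m W c).Nonempty)
    (hli : LinearIndependent ℚ (fun c : T => leadVecZ m W π (c : Fin 3 → Fin (qOf m)))) :
    AlgebraicIndependent ℂ (fun c : T => kiPerZ m W π (c : Fin 3 → Fin (qOf m))) := by
  classical
  rw [algebraicIndependent_iff]
  intro p hp
  by_contra hp0
  have hD : rename ((↑) : T → (Fin 3 → Fin (qOf m))) p ≠ 0 := fun h =>
    hp0 (rename_injective _ Subtype.val_injective (by rw [h, map_zero]))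
  have hT : ∀ e ∈ (rename ((↑) : T → (Fin 3 → Fin (qOf m))) p).support, e ∈ {e | e.support ⊆ T} := by
    intro e he
    rw [support_rename_of_injective Subtype.val_injective] at he
    obtain ⟨e', -, rfl⟩ := Finset.mem_image.1 he
    show (Finsupp.mapDomain _ e').support ⊆ T
    rw [Finsupp.mapDomain_support_of_injective Subtype.val_injective]
    intro c hc
    obtain ⟨c', -, rfl⟩ := Finset.mem_image.1 hc
    exact c'.2
  apply kiPerZ_hits_of_injOn m hπ {e | e.support ⊆ T} (injOn_of_linearIndependentZ m W π T hli)
    (fun e he c hc => hA c (he hc)) _ hD hT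
  rw [← aeval_eq_bind₁, aeval_rename]
  exact hp

/-- **Zero-pattern ranking certificate ⟹ algebraic independence of the BLOCKS (kernel).** [this file] -/
theorem kiPer_algebraicIndependent_of_linearIndependentZ (m : ℕ) {W : Finset (Fin (qOf m) × Fin (qOf m))}
    {π : (Fin (qOf m) × Fin (qOf m)) → τ} (hπ : Function.Injective π) (T : Finset (Fin 3 → Fin (qOf m)))
    (hA : ∀ c ∈ T, (avoidSet m W c).Nonempty)
    (hli : LinearIndependent ℚ (fun c : T => leadVecZ m W π (c : Fin 3 → Fin (qOf m)))) :
    AlgebraicIndependent ℂ (fun c : T => kiPer m (c : Fin 3 → Fin (qOf m))) := by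
  classical
  have h := kiPerZ_algebraicIndependent_of_linearIndependent m hπ T hA hli
  refine AlgebraicIndependent.of_comp ((rename π).comp (zeroSpec W)) ?_
  have hc : ((rename π).comp (zeroSpec W)) ∘ (fun c : T => kiPer m (c : Fin 3 → Fin (qOf m))) =
      fun c : T => kiPerZ m W π (c : Fin 3 → Fin (qOf m)) := by
    funext c
    simp only [Function.comp_apply, AlgHom.comp_apply, kiPerZ_eq]
  rw [hc]
  exact h

end Summit.ValiantsHypothesis.ValiantsHypothesis.Theorems.DefinabilityGapZeroSpecialisation

end
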